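import Summits.ValiantsHypothesis.ValiantsHypothesis.Theorems.BarrierLeverAnchoredDoorHitsLowerPairsDefs
import Summits.ValiantsHypothesis.ValiantsHypothesis.Theorems.BarrierLeverPartitionMinorsHitByVPBrickCalculus

/-!
# Support item `AnchoredDoorHitsLowerPairs` (stmt-ValiantsHypothesis-22510), line `anchored-peeling`:
# the STAR-STEP SPECIALISATION (entries of the specialised symbolic layout matrix)

Helper file towards the registered stub `stub_starStep` of the skeleton
`Cruxes/AnchoredDoorHitsLowerPairs/Lines/anchored_peeling.lean` (v3; planner valiant-natproofs-p1 g19, D-0145; lane val-np-p1).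
Cell valiant-natproofs, rung V4, 𝒟-side door (c); prover seat val-np-p1 gen 15. Closes NO item (`--supports stmt-ValiantsHypothesis-22510`).

THE MECHANISM (a one-variable form of the λ-scaling of HOME/val-np-p1/g14/ANCHORED-MEMO-valnp1-g14.md §3/§6.1). Write the symbolic
anchored witness as `symbolicWitness s h = symbFactor h α⋆ * symbRest s h α⋆` for a distinguished anchor `α⋆ = (A⋆ | B⋆)`. The ring map
`specHom α⋆ P Q : ℂ[θ, φ, ψ] → ℂ[θ, φ, ψ][T]` sends `θ_{α⋆} ↦ T`, the twists `φ_{α⋆ b} ↦ T` (`b ∈ P`), `ψ_{α⋆ d} ↦ T` (`d ∈ Q`), every other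
twist of `α⋆` to `0`, and every other parameter to itself (as a constant). Then (`map_specHom_symbFactor_self`) the distinguished factor
becomes `1 + Σ_{Z'' ⊆ P, W'' ⊆ Q} T^{|Z''|+|W''|+1} x^{A⋆ ∪ Z''} y^{B⋆ ∪ W''}`, the other factors are unchanged (`map_specHom_symbRest`), and the
entries of the specialised layout matrix are (`coeff_map_specHom_symbolicWitness`)
`C L°[S,T] + Σ_{Z'',W''} [A⋆ ∪ Z'' ⊆ S][B⋆ ∪ W'' ⊆ T] · T^{|Z''|+|W''|+1} · L°[S ∖ (A⋆ ∪ Z''), T ∖ (B⋆ ∪ W'')]`, `L° = layout of symbRest`.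
Off the support of the anchor the full and the reduced layouts agree (`coeff_symbolicWitness_eq_rest`). Generic tools: the top
`T`-coefficient of a determinant under column / row degree bounds (`coeff_det_of_natDegree_le[_row]`), and the degree / top coefficient
of the entry shape `C c₀ + Σ_{Z ⊆ P} [cond Z] · monomial (|Z|+1) (c Z)` (`natDegree_entry_le`, `coeff_entry_top`).
Also here: the registered stub STATEMENT `Stmt.stub_starStep` (verbatim from the skeleton), the column-permutation invariance of
non-vanishing (`symbolicDet_ne_zero_of_perm`) and the ALIGNMENT of two equal stars by a column permutation (`exists_align`). The star
step itself (the two cases `|W| ≤ s` / `|Z| ≤ s`, block-triangularity, `theorem stub_starStep`) is the sequel file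
`…AnchoredDoorHitsLowerPairsStarStep` (definition-free).

WHAT THIS IS NOT: no statement about items 22510 / 19717 themselves; nothing on crux stmt-ValiantsHypothesis-14610 or on `VP` versus `VNP`.
-/

set_option linter.dupNamespace false

namespace Summit.ValiantsHypothesis.ValiantsHypothesis.Theorems.BarrierLever.AnchoredPeeling

open Finset MvPolynomial
open Summit.ValiantsHypothesis.ValiantsHypothesis.Theorems.BarrierLever.BrickCalculus (pexpo pexpo_def pexpo_le_iff pexpo_sub)

noncomputable section

/-! ## 1. Top coefficient of a determinant under column / row degree bounds -/

section TopCoeff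

variable {A : Type*} [CommRing A]

/-- If `natDegree (f i) ≤ d i` on `s`, then `∏ f` has degree `≤ Σ d` and its coefficient at `Σ d` is `∏ coeff (f i) (d i)`. -/
theorem natDegree_prod_le_and_coeff_top {ι : Type*} (s : Finset ι) (f : ι → Polynomial A) (d : ι → ℕ)
    (hd : ∀ i ∈ s, (f i).natDegree ≤ d i) :
    (∏ i ∈ s, f i).natDegree ≤ ∑ i ∈ s, d i ∧
      (∏ i ∈ s, f i).coeff (∑ i ∈ s, d i) = ∏ i ∈ s, (f i).coeff (d i) := by
  classical
  induction s using Finset.induction_on with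
  | empty => simp
  | insert a s ha ih =>
    obtain ⟨hdeg, hcoeff⟩ := ih fun i hi => hd i (Finset.mem_insert_of_mem hi)
    have ha' := hd a (Finset.mem_insert_self a s)
    rw [Finset.prod_insert ha, Finset.sum_insert ha, Finset.prod_insert ha]
    exact ⟨Polynomial.natDegree_mul_le.trans (Nat.add_le_add ha' hdeg),
      by rw [Polynomial.coeff_mul_add_eq_of_natDegree_le ha' hdeg, hcoeff]⟩

variable {n : Type*} [Fintype n] [DecidableEq n]

/-- **Top coefficient of a determinant, column degree bounds.** If every entry of column `j` has degree `≤ d j`, the coefficient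
of `T^{Σ d}` in `det P` is the determinant of the matrix of the coefficients `[T^{d j}] P i j`. -/
theorem coeff_det_of_natDegree_le (P : Matrix n n (Polynomial A)) (d : n → ℕ)
    (hd : ∀ i j, (P i j).natDegree ≤ d j) :
    P.det.coeff (∑ j, d j) = (Matrix.of fun i j => (P i j).coeff (d j)).det := by
  rw [Matrix.det_apply', Matrix.det_apply', Polynomial.finsetSum_coeff]
  refine Finset.sum_congr rfl (fun σ _ => ?_)
  rw [← map_intCast (Polynomial.C : A →+* Polynomial A), Polynomial.coeff_C_mul]
  congr 1
  rw [(natDegree_prod_le_and_coeff_top Finset.univ (fun i => P (σ i) i) d (fun i _ => hd (σ i) i)).2]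
  rfl

/-- **Top coefficient of a determinant, row degree bounds** (transpose of the previous). -/
theorem coeff_det_of_natDegree_le_row (P : Matrix n n (Polynomial A)) (d : n → ℕ)
    (hd : ∀ i j, (P i j).natDegree ≤ d i) :
    P.det.coeff (∑ i, d i) = (Matrix.of fun i j => (P i j).coeff (d i)).det := by
  rw [← Matrix.det_transpose, coeff_det_of_natDegree_le P.transpose d (fun i j => hd j i), ← Matrix.det_transpose]
  rfl

/-- Degree of the entry shape `C c₀ + Σ_{Z ⊆ P} [cond Z] · monomial (|Z|+1) (c Z)`: at most `|P| + 1`. -/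
theorem natDegree_entry_le {β : Type*} (c₀ : A) (P : Finset β) (cond : Finset β → Prop) [DecidablePred cond]
    (c : Finset β → A) :
    (Polynomial.C c₀ + ∑ Z ∈ P.powerset, (if cond Z then Polynomial.monomial (Z.card + 1) (c Z) else 0)).natDegree ≤
      P.card + 1 := by
  refine (Polynomial.natDegree_add_le _ _).trans (max_le (by rw [Polynomial.natDegree_C]; exact Nat.zero_le _) ?_)
  refine Polynomial.natDegree_sum_le_of_forall_le _ _ (fun Z hZ => ?_)
  split_ifs
  · exact (Polynomial.natDegree_monomial_le _).trans
      (Nat.add_le_add_right (Finset.card_le_card (Finset.mem_powerset.mp hZ)) 1)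
  · rw [Polynomial.natDegree_zero]; exact Nat.zero_le _

/-- Top coefficient of the entry shape: only the term `Z = P` reaches degree `|P| + 1`. -/
theorem coeff_entry_top {β : Type*} (c₀ : A) (P : Finset β) (cond : Finset β → Prop) [DecidablePred cond]
    (c : Finset β → A) :
    (Polynomial.C c₀ + ∑ Z ∈ P.powerset, (if cond Z then Polynomial.monomial (Z.card + 1) (c Z) else 0)).coeff
      (P.card + 1) = if cond P then c P else 0 := by
  rw [Polynomial.coeff_add, Polynomial.coeff_C, if_neg (Nat.succ_ne_zero _), zero_add, Polynomial.finsetSum_coeff,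
    Finset.sum_eq_single P]
  · split_ifs
    · rw [Polynomial.coeff_monomial, if_pos rfl]
    · rw [Polynomial.coeff_zero]
  · intro Z hZ hZP
    have hlt : Z.card < P.card :=
      Finset.card_lt_card (lt_of_le_of_ne (Finset.mem_powerset.mp hZ) hZP)
    split_ifs
    · rw [Polynomial.coeff_monomial, if_neg (by omega)]
    · rw [Polynomial.coeff_zero]
  · intro hP
    exact absurd (Finset.mem_powerset.mpr subset_rfl) hP

end TopCoeff

/-! ## 2. The factors of the symbolic witness and the specialisation map -/

variable {h : ℕ}

/-- The factor of the symbolic anchored witness at the anchor `α = (A | B)` (verbatim body of `symbolicWitness`). -/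
def symbFactor (h : ℕ) (α : Finset (Fin h) × Finset (Fin h)) :
    MvPolynomial (Fin (h + h)) (MvPolynomial (Param h) ℂ) :=
  1 + C (X (Sum.inl α)) * (∏ a ∈ α.1, X (Fin.castAdd h a)) * (∏ c ∈ α.2, X (Fin.natAdd h c)) *
    (∏ b ∈ univ \ α.1, (1 + C (X (Sum.inr (Sum.inl (α, b)))) * X (Fin.castAdd h b))) *
    (∏ d ∈ univ \ α.2, (1 + C (X (Sum.inr (Sum.inr (α, d)))) * X (Fin.natAdd h d)))

/-- The symbolic witness with the distinguished anchor's factor removed. -/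
def symbRest (s h : ℕ) (αs : Finset (Fin h) × Finset (Fin h)) :
    MvPolynomial (Fin (h + h)) (MvPolynomial (Param h) ℂ) :=
  ∏ α ∈ (anchors s h).erase αs, symbFactor h α

/-- The layout entries `L°[S,T] = [x^S y^T] symbRest` of the reduced witness. -/
def restEntry (s h : ℕ) (αs : Finset (Fin h) × Finset (Fin h)) (S T : Finset (Fin h)) : MvPolynomial (Param h) ℂ :=
  coeff (pexpo S T) (symbRest s h αs)

/-- The symbolic witness is the product of its anchor factors. -/
theorem symbolicWitness_eq_prod (s h : ℕ) : symbolicWitness s h = ∏ α ∈ anchors s h, symbFactor h α := rfl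

/-- Splitting off the distinguished factor. -/
theorem symbolicWitness_eq_mul (s h : ℕ) {αs : Finset (Fin h) × Finset (Fin h)} (hαs : αs ∈ anchors s h) :
    symbolicWitness s h = symbFactor h αs * symbRest s h αs := by
  rw [symbolicWitness_eq_prod, symbRest, Finset.mul_prod_erase _ _ hαs]

/-- A product of distinct variables is a monomial (any coefficient ring). -/
theorem prod_X_eq_monomial' {R : Type*} [CommSemiring R] {ι : Type*} (s : Finset ι) (e : ι → Fin (h + h)) :
    (∏ i ∈ s, X (e i) : MvPolynomial (Fin (h + h)) R) = monomial (∑ i ∈ s, Finsupp.single (e i) 1) 1 := by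
  classical
  induction s using Finset.induction_on with
  | empty => simp
  | insert i s hi ih =>
    rw [Finset.prod_insert hi, Finset.sum_insert hi, ih, X, monomial_mul, one_mul]

/-- The anchor factor with its monomial `x^A y^B` exposed. -/
theorem symbFactor_eq (α : Finset (Fin h) × Finset (Fin h)) :
    symbFactor h α = 1 + monomial (pexpo α.1 α.2) 1 * (C (X (Sum.inl α)) *
      (∏ b ∈ univ \ α.1, (1 + C (X (Sum.inr (Sum.inl (α, b)))) * X (Fin.castAdd h b))) *
      (∏ d ∈ univ \ α.2, (1 + C (X (Sum.inr (Sum.inr (α, d)))) * X (Fin.natAdd h d)))) := by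
  rw [symbFactor, prod_X_eq_monomial', prod_X_eq_monomial', pexpo_def,
    show monomial ((∑ a ∈ α.1, Finsupp.single (Fin.castAdd h a) 1) + ∑ c ∈ α.2, Finsupp.single (Fin.natAdd h c) 1)
        (1 : MvPolynomial (Param h) ℂ) =
      monomial (∑ a ∈ α.1, Finsupp.single (Fin.castAdd h a) 1) 1 *
        monomial (∑ c ∈ α.2, Finsupp.single (Fin.natAdd h c) 1) 1 by rw [monomial_mul, mul_one]]
  ring

/-- **Off the anchor's support the full and the reduced layouts agree**: if `¬ (A⋆ ⊆ S ∧ B⋆ ⊆ T)` then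
`coeff_{x^S y^T} symbolicWitness = L°[S,T]`. -/
theorem coeff_symbolicWitness_eq_rest (s h : ℕ) {αs : Finset (Fin h) × Finset (Fin h)} (hαs : αs ∈ anchors s h)
    (S T : Finset (Fin h)) (hnot : ¬ (αs.1 ⊆ S ∧ αs.2 ⊆ T)) :
    coeff (pexpo S T) (symbolicWitness s h) = restEntry s h αs S T := by
  classical
  rw [restEntry, symbolicWitness_eq_mul s h hαs, symbFactor_eq, add_mul, one_mul, coeff_add, mul_assoc,
    coeff_monomial_mul', if_neg (fun hle => hnot ((pexpo_le_iff _ _ _ _).mp hle)), add_zero]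

/-- The one-variable specialisation of the parameters at the distinguished anchor `α⋆` with scaled twist sets `P` (x-side)
and `Q` (y-side): `θ_{α⋆} ↦ T`, `φ_{α⋆ b} ↦ T` for `b ∈ P` and `0` otherwise, `ψ_{α⋆ d} ↦ T` for `d ∈ Q` and `0` otherwise; all
other parameters stay (as constants of `ℂ[θ,φ,ψ][T]`). -/
def starSpec (αs : Finset (Fin h) × Finset (Fin h)) (P Q : Finset (Fin h)) :
    Param h → Polynomial (MvPolynomial (Param h) ℂ)
  | Sum.inl α => if α = αs then Polynomial.X else Polynomial.C (X (Sum.inl α))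
  | Sum.inr (Sum.inl (α, b)) =>
      if α = αs then (if b ∈ P then Polynomial.X else 0) else Polynomial.C (X (Sum.inr (Sum.inl (α, b))))
  | Sum.inr (Sum.inr (α, d)) =>
      if α = αs then (if d ∈ Q then Polynomial.X else 0) else Polynomial.C (X (Sum.inr (Sum.inr (α, d))))

/-- The specialisation as a ring map `ℂ[θ, φ, ψ] → ℂ[θ, φ, ψ][T]`. -/
def specHom (αs : Finset (Fin h) × Finset (Fin h)) (P Q : Finset (Fin h)) :
    MvPolynomial (Param h) ℂ →+* Polynomial (MvPolynomial (Param h) ℂ) :=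
  (aeval (starSpec αs P Q)).toRingHom

/-- The specialisation on a parameter variable. -/
theorem specHom_X (αs : Finset (Fin h) × Finset (Fin h)) (P Q : Finset (Fin h)) (v : Param h) :
    specHom αs P Q (X v) = starSpec αs P Q v := by
  rw [specHom, AlgHom.toRingHom_eq_coe, RingHom.coe_coe, aeval_X]

/-! ## 3. The specialised factors -/

/-- The other anchors' factors are unchanged (their parameters become constants). -/
theorem map_specHom_symbFactor_of_ne {αs α : Finset (Fin h) × Finset (Fin h)} (P Q : Finset (Fin h)) (hne : α ≠ αs) :
    MvPolynomial.map (specHom αs P Q) (symbFactor h α) = MvPolynomial.map Polynomial.C (symbFactor h α) := by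
  rw [symbFactor]
  simp only [map_add, map_one, map_mul, map_prod, map_C, map_X, specHom_X, starSpec, if_neg hne]

/-- Hence the reduced witness is unchanged. -/
theorem map_specHom_symbRest (s h : ℕ) (αs : Finset (Fin h) × Finset (Fin h)) (P Q : Finset (Fin h)) :
    MvPolynomial.map (specHom αs P Q) (symbRest s h αs) = MvPolynomial.map Polynomial.C (symbRest s h αs) := by
  rw [symbRest, map_prod, map_prod]
  exact Finset.prod_congr rfl (fun α hα => map_specHom_symbFactor_of_ne P Q (Finset.ne_of_mem_erase hα))

/-- A scaled twist product: the twists outside `P` die, those inside become `1 + T·x_b`. -/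
theorem prod_twist_spec {A : Finset (Fin h)} {P : Finset (Fin h)} (hP : P ⊆ univ \ A) (e : Fin h → Fin (h + h)) :
    (∏ b ∈ univ \ A, (1 + C (if b ∈ P then (Polynomial.X : Polynomial (MvPolynomial (Param h) ℂ)) else 0) * X (e b)) :
        MvPolynomial (Fin (h + h)) (Polynomial (MvPolynomial (Param h) ℂ))) =
      ∏ b ∈ P, (1 + C Polynomial.X * X (e b)) := by
  rw [← Finset.prod_subset hP (fun b _ hbP => by rw [if_neg hbP, map_zero, zero_mul, add_zero])]
  exact Finset.prod_congr rfl (fun b hb => by rw [if_pos hb])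

/-- Expanding `∏_{b ∈ P} (1 + t·X_{e b}) = Σ_{Z ⊆ P} t^{|Z|} · ∏_{b ∈ Z} X_{e b}`. -/
theorem prod_one_add_C_mul_X {R : Type*} [CommSemiring R] (t : R) (P : Finset (Fin h)) (e : Fin h → Fin (h + h)) :
    (∏ b ∈ P, (1 + C t * X (e b)) : MvPolynomial (Fin (h + h)) R) =
      ∑ Z ∈ P.powerset, C (t ^ Z.card) * ∏ b ∈ Z, X (e b) := by
  rw [Finset.prod_one_add]
  refine Finset.sum_congr rfl (fun Z _ => ?_)
  rw [Finset.prod_mul_distrib, Finset.prod_const, map_pow]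

/-- Union of disjoint square-free exponents. -/
theorem pexpo_union {A Z B W : Finset (Fin h)} (hA : Disjoint A Z) (hB : Disjoint B W) :
    pexpo (A ∪ Z) (B ∪ W) = pexpo A B + pexpo Z W := by
  rw [pexpo_def, pexpo_def, pexpo_def, Finset.sum_union hA, Finset.sum_union hB]
  abel

/-- **The specialised distinguished factor**: `1 + Σ_{Z'' ⊆ P, W'' ⊆ Q} T^{|Z''|+|W''|+1} · x^{A⋆ ∪ Z''} y^{B⋆ ∪ W''}`. -/
theorem map_specHom_symbFactor_self (αs : Finset (Fin h) × Finset (Fin h)) {P Q : Finset (Fin h)}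
    (hP : P ⊆ univ \ αs.1) (hQ : Q ⊆ univ \ αs.2) :
    MvPolynomial.map (specHom αs P Q) (symbFactor h αs) =
      1 + ∑ Z ∈ P.powerset, ∑ W ∈ Q.powerset,
        C (Polynomial.X ^ (Z.card + W.card + 1)) * monomial (pexpo (αs.1 ∪ Z) (αs.2 ∪ W)) 1 := by
  classical
  rw [symbFactor]
  simp only [map_add, map_one, map_mul, map_prod, map_C, map_X, specHom_X, starSpec, ↓reduceIte]
  rw [prod_twist_spec hP, prod_twist_spec hQ, prod_one_add_C_mul_X, prod_one_add_C_mul_X,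
    mul_assoc _ (∑ Z ∈ P.powerset, _) (∑ W ∈ Q.powerset, _), Finset.sum_mul_sum, Finset.mul_sum]
  congr 1
  refine Finset.sum_congr rfl (fun Z hZ => ?_)
  rw [Finset.mul_sum]
  refine Finset.sum_congr rfl (fun W hW => ?_)
  have hdA : Disjoint αs.1 Z :=
    Finset.disjoint_of_subset_right (Finset.mem_powerset.mp hZ)
      (Finset.disjoint_of_subset_right hP Finset.disjoint_sdiff)
  have hdB : Disjoint αs.2 W :=
    Finset.disjoint_of_subset_right (Finset.mem_powerset.mp hW)
      (Finset.disjoint_of_subset_right hQ Finset.disjoint_sdiff)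
  calc _ = (C (Polynomial.X ^ Z.card) * C (Polynomial.X ^ W.card) * C Polynomial.X) *
          (((∏ a ∈ αs.1, X (Fin.castAdd h a)) * ∏ b ∈ Z, X (Fin.castAdd h b)) *
           ((∏ c ∈ αs.2, X (Fin.natAdd h c)) * ∏ d ∈ W, X (Fin.natAdd h d))) := by ring
    _ = C (Polynomial.X ^ (Z.card + W.card + 1)) * monomial (pexpo (αs.1 ∪ Z) (αs.2 ∪ W)) 1 := by
        rw [← Finset.prod_union hdA, ← Finset.prod_union hdB, prod_X_eq_monomial', prod_X_eq_monomial',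
          monomial_mul, mul_one, ← pexpo_def, ← map_mul, ← map_mul, ← pow_add, ← pow_succ]

/-! ## 4. The entries of the specialised layout matrix -/

/-- **Entry formula.** `[x^S y^T] specHom(symbolicWitness)
  = C L°[S,T] + Σ_{Z'' ⊆ P, W'' ⊆ Q} [A⋆ ∪ Z'' ⊆ S ∧ B⋆ ∪ W'' ⊆ T] · T^{|Z''|+|W''|+1} · L°[S ∖ (A⋆ ∪ Z''), T ∖ (B⋆ ∪ W'')]`,
where `L°` is the layout of `symbRest`. -/
theorem coeff_map_specHom_symbolicWitness (s h : ℕ) {αs : Finset (Fin h) × Finset (Fin h)} (hαs : αs ∈ anchors s h)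
    {P Q : Finset (Fin h)} (hP : P ⊆ univ \ αs.1) (hQ : Q ⊆ univ \ αs.2) (S T : Finset (Fin h)) :
    coeff (pexpo S T) (MvPolynomial.map (specHom αs P Q) (symbolicWitness s h)) =
      Polynomial.C (restEntry s h αs S T) +
        ∑ Z ∈ P.powerset, ∑ W ∈ Q.powerset,
          (if αs.1 ∪ Z ⊆ S ∧ αs.2 ∪ W ⊆ T then
            Polynomial.monomial (Z.card + W.card + 1) (restEntry s h αs (S \ (αs.1 ∪ Z)) (T \ (αs.2 ∪ W)))
          else 0) := by
  classical
  simp only [restEntry]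
  rw [symbolicWitness_eq_mul s h hαs, map_mul, map_specHom_symbFactor_self αs hP hQ, map_specHom_symbRest, add_mul,
    one_mul, coeff_add, coeff_map]
  congr 1
  rw [Finset.sum_mul, coeff_sum]
  refine Finset.sum_congr rfl (fun Z _ => ?_)
  rw [Finset.sum_mul, coeff_sum]
  refine Finset.sum_congr rfl (fun W _ => ?_)
  rw [mul_assoc, coeff_C_mul, coeff_monomial_mul']
  by_cases hle : αs.1 ∪ Z ⊆ S ∧ αs.2 ∪ W ⊆ T
  · rw [if_pos ((pexpo_le_iff _ _ _ _).mpr hle), if_pos hle, one_mul, pexpo_sub _ _ _ _ hle.1 hle.2, coeff_map,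
      mul_comm, Polynomial.C_mul_X_pow_eq_monomial]
  · rw [if_neg (fun h' => hle ((pexpo_le_iff _ _ _ _).mp h')), if_neg hle, mul_zero]


/-! ## 5. The registered stub statement (verbatim) -/

/-- SUB-STUB A (star step; PROVED on paper = memo §3/§6.1 «Lemma 1𝔄»). Faces `Z ∈ R`, `W ∈ C`, one of size `≤ s`, with EQUAL STAR
COUNTS; the symbolic minor of `(R, C)` is nonzero if those of the DELETION pair and of the LINK pair are. (Verbatim from the skeleton
`Cruxes/AnchoredDoorHitsLowerPairs/Lines/anchored_peeling.lean`.) -/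
def Stmt.stub_starStep : Prop :=
  ∀ (s h r : ℕ) (u w : Fin r → Finset (Fin h)), Function.Injective u → Function.Injective w →
    IsLowerSet (Set.range u) → IsLowerSet (Set.range w) →
    ∀ (Z W : Finset (Fin h)), Z ∈ Set.range u → W ∈ Set.range w → 1 ≤ Z.card → 1 ≤ W.card →
      (Z.card ≤ s ∨ W.card ≤ s) →
      (Finset.univ.filter (fun i => Z ⊆ u i)).card = (Finset.univ.filter (fun j => W ⊆ w j)).card →
      (∀ (r₀ : ℕ) (u₀ w₀ : Fin r₀ → Finset (Fin h)), Function.Injective u₀ → Function.Injective w₀ →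
          Set.range u₀ = {S | S ∈ Set.range u ∧ ¬ Z ⊆ S} → Set.range w₀ = {T | T ∈ Set.range w ∧ ¬ W ⊆ T} →
          symbolicDet s h r₀ u₀ w₀ ≠ 0) →
      (∀ (r₁ : ℕ) (u₁ w₁ : Fin r₁ → Finset (Fin h)), Function.Injective u₁ → Function.Injective w₁ →
          Set.range u₁ = {S | Disjoint S Z ∧ S ∪ Z ∈ Set.range u} → Set.range w₁ = {T | Disjoint T W ∧ T ∪ W ∈ Set.range w} →
          symbolicDet s h r₁ u₁ w₁ ≠ 0) →
      symbolicDet s h r u w ≠ 0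

/-! ## 6. Permuting the columns; aligning the two stars -/

section Align

variable {h : ℕ}

/-- Permuting the columns of a layout multiplies the symbolic minor by a sign; in particular non-vanishing transfers back. -/
theorem symbolicDet_ne_zero_of_perm (s h r : ℕ) (u w : Fin r → Finset (Fin h)) (π : Equiv.Perm (Fin r))
    (hne : symbolicDet s h r u (w ∘ π) ≠ 0) : symbolicDet s h r u w ≠ 0 := by
  intro h0
  apply hne
  have h1 : symbolicDet s h r u (w ∘ π) =
      ((Matrix.of fun i j : Fin r => coeff (pexpo (u i) (w j)) (symbolicWitness s h)).submatrix id π).det := rfl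
  have h2 : (Matrix.of fun i j : Fin r => coeff (pexpo (u i) (w j)) (symbolicWitness s h)).det = symbolicDet s h r u w :=
    rfl
  rw [h1, Matrix.det_permute', h2, h0, mul_zero]

/-- **Alignment.** If the two stars have the same size, some column permutation makes «row `i` lies in the `Z`-star» and
«column `i` lies in the `W`-star» the same predicate. -/
theorem exists_align {r : ℕ} (u w : Fin r → Finset (Fin h)) (Z W : Finset (Fin h))
    (hcnt : (Finset.univ.filter (fun i => Z ⊆ u i)).card = (Finset.univ.filter (fun j => W ⊆ w j)).card) :
    ∃ π : Equiv.Perm (Fin r), ∀ i, Z ⊆ u i ↔ W ⊆ w (π i) := by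
  classical
  have h1 : Fintype.card {i : Fin r // Z ⊆ u i} = Fintype.card {j : Fin r // W ⊆ w j} := by
    rw [Fintype.card_subtype, Fintype.card_subtype, hcnt]
  have h0 : Fintype.card {i : Fin r // ¬ Z ⊆ u i} = Fintype.card {j : Fin r // ¬ W ⊆ w j} := by
    rw [Fintype.card_subtype_compl, Fintype.card_subtype_compl, h1]
  refine ⟨(Equiv.sumCompl fun i => Z ⊆ u i).symm.trans
      (((Fintype.equivOfCardEq h1).sumCongr (Fintype.equivOfCardEq h0)).trans (Equiv.sumCompl fun j => W ⊆ w j)),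
    fun i => ?_⟩
  by_cases hi : Z ⊆ u i
  · rw [Equiv.trans_apply, Equiv.trans_apply, Equiv.sumCompl_symm_apply_of_pos (p := fun i => Z ⊆ u i) hi, Equiv.sumCongr_apply, Sum.map_inl,
      Equiv.sumCompl_apply_inl]
    exact ⟨fun _ => (Fintype.equivOfCardEq h1 ⟨i, hi⟩).2, fun _ => hi⟩
  · rw [Equiv.trans_apply, Equiv.trans_apply, Equiv.sumCompl_symm_apply_of_neg (p := fun i => Z ⊆ u i) hi, Equiv.sumCongr_apply, Sum.map_inr,
      Equiv.sumCompl_apply_inr]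
    exact ⟨fun h' => absurd h' hi, fun h' => absurd h' (Fintype.equivOfCardEq h0 ⟨i, hi⟩).2⟩

end Align

end

end Summit.ValiantsHypothesis.ValiantsHypothesis.Theorems.BarrierLever.AnchoredPeeling
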